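import Summits.AnomalousDissipation.AnomalousDissipation.Theorems.SolenoidalFractalHomogenisationLagrangianStepCellChainBareDecay
import Summits.AnomalousDissipation.AnomalousDissipation.Theorems.SolenoidalFractalHomogenisationLagrangianStepCellChainSetupFrame
import Summits.AnomalousDissipation.AnomalousDissipation.Theorems.SolenoidalFractalHomogenisationLagrangianStepCellChainGapFrame
import Summits.AnomalousDissipation.AnomalousDissipation.Theorems.SolenoidalFractalHomogenisationLagrangianStepOneLevelSplitDefsW7Frame
import HarnessLib

/-!
# K1L_D (stmt-AnomalousDissipation-27980), (ℓ3) (D-TH)₀ — `ClassDecayWθ` ON THE FAR CLASSES BY BARE DISSIPATION (frozen frame)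
# (helper; `--supports stmt-AnomalousDissipation-27980 --as helper`)

Port plan B7 (`HOME/ad-sawtooth-k1loc-p1/g16/W7thg-portplan-k1locp1g16.md`; prover ad-sawtooth-k1loc-p1 g16): the frozen-frame twin of
`CellChain.classDecayW_bare` (`…CellChainBareDecay`).  At a CONSTANT non-degenerate frame `G₀` (`c₀|k|² ≤ |G₀ᵀk|²`, `0 < c₀`) the per-mode
coercivity of the conjugated symbol is `(1/n²)(νlo/Λ)·c₀·|k|²`, so a class pair at distance `≥ κ·n` from the lattice decays by bare dissipation at the
ν-uniform rate `cK = 4π²·lo·c₀·κ²/Λ` with prefactor `1`: `ClassDecayWθ G₀ W M hM lo hi Λ β ν₀ Kb 1 (4π²·lo·c₀·κ²/Λ) (far classes)`.  Inputs: the frozen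
set-up `classDecayWθ_setup` (energy package + confinement + coercivity, p729244), the frozen gap `ae_gap_lower_bound_frame` (p729391), the pure
`energy_le_exp_of_gap` and `freqNormSq_ge_of_classPair` (reused).
* `classDecayWθ_bare`.
No definitions, no sorry.  NOT a proof of `stub_W7thg`, of K1L_D or of AD; rung F-D1.A0.
[cite: Temam1984, Ch. III §1 Lemma 1.2 (energy inequality)] [problem: turb]
-/

set_option linter.dupNamespace false

noncomputable section

namespace Summit.AnomalousDissipation.AnomalousDissipation.Theorems.SolenoidalFractalHomogenisation.LagrangianStep.CellChain

open Set MeasureTheory Filter Topology Function Complex UnitAddTorus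
open scoped InnerProductSpace ComplexConjugate
open Literature.Analysis Literature.Analysis.FunctionSpaces Literature.Analysis.FunctionSpaces.Torus
open Literature.Analysis.FluidPDE Literature.Analysis.FluidPDE.Torus Literature.Analysis.FluidPDE.LatticeShear
open Summit.AnomalousDissipation.AnomalousDissipation.Theorems.SolenoidalFractalHomogenisation.RealisedQuasiStaticCellLaw
open Summit.AnomalousDissipation.AnomalousDissipation.Theorems.SolenoidalFractalHomogenisation.LagrangianStep
open Summit.AnomalousDissipation.AnomalousDissipation.Theorems.SolenoidalFractalHomogenisation.LagrangianStep.W7Engine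

/-- **`ClassDecayWθ` ON THE FAR CLASSES BY BARE DISSIPATION** at a constant non-degenerate frame `G₀` (`c₀|k|² ≤ |G₀ᵀk|²`, `0 < c₀`): for every word,
pre-stretch, window with `0 < lo`, `0 ≤ hi`, `1 ≤ Λ`, every `ν₀, Kb`, `κ > 0`:
`ClassDecayWθ G₀ W M hM lo hi Λ β ν₀ Kb 1 (4π²·lo·c₀·κ²/Λ) (fun n ν ℓ => ∀ z, κ·n ≤ ‖ℓ + n·z‖)`. [cite: Temam1984, Ch. III §1 Lemma 1.2 (energy inequality)] -/
theorem classDecayWθ_bare {G₀ : Matrix (Fin 3) (Fin 3) ℝ} {c₀ : ℝ} (hc₀ : 0 < c₀) (hG : ∀ k' : Fin 3 → ℤ, c₀ * freqNormSq k' ≤ ∑ a, Torus.twistFreq G₀ k' a ^ 2)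
    {k : ℕ} (W : LatticeWord k) (M : ℝ) (hM : 0 < M) {lo hi Λ : ℝ} (hlo : 0 < lo) (hhi : 0 ≤ hi) (hΛ : 1 ≤ Λ)
    (β ν₀ Kb : ℝ) {κ : ℝ} (hκ : 0 < κ) :
    ClassDecayWθ G₀ W M hM lo hi Λ β ν₀ Kb 1 (4 * Real.pi ^ 2 * lo * c₀ * κ ^ 2 / Λ)
      (fun n _ ℓ => ∀ z : Fin 3 → ℤ, κ * n ≤ ‖Torus.latticeVec (ℓ + (n : ℤ) • z)‖) := by
  intro ν hν n hn 𝔸 _ hwin L _ _ ℓ _ hfar F hF1 hF2 hF3 hsupp T hT u hu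
  have hn0 : 0 < n := hn
  have hnR : (0:ℝ) < n := by exact_mod_cast hn0
  have hΛ0 : 0 < Λ := lt_of_lt_of_le one_pos hΛ
  obtain ⟨hN, ⟨hFl2, hFi, _⟩, ⟨E, Q, hE0, _, _, _, hAC, hEae, _, _, hEd, hQblock, hcoer⟩, hclass, _⟩ :=
    classDecayWθ_setup W M hM hlo hhi hΛ hν.1 hn hwin hc₀ hG ℓ hF1 hF3 hsupp hT hu
  have hlo' : 0 ≤ (1 / (n:ℝ) ^ 2) * (ν * (lo / Λ)) * c₀ := by
    have := hν.1
    positivity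
  have hcoer' : ∀ᵐ t ∂(volume.restrict (Ioo 0 T)), ∀ k' : Fin 3 → ℤ,
      (1 / (n:ℝ) ^ 2) * (ν * (lo / Λ)) * c₀ * (freqNormSq k' * ‖mFourierCoeff (EuclideanSpace.complexify ∘ u t) k'‖ ^ 2) ≤
        (⟪mFourierCoeff (EuclideanSpace.complexify ∘ u t) k',
          Torus.symbT (Torus.Visc4.conj G₀ ((1 / (n:ℝ) ^ 2) • 𝔸)) k' (mFourierCoeff (EuclideanSpace.complexify ∘ u t) k')⟫_ℂ).re := by
    filter_upwards [hcoer] with t ht k'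
    exact (ht k').2
  have hgap : ∀ᵐ t ∂(volume.restrict (Ioo 0 T)), ∀ k', mFourierCoeff (EuclideanSpace.complexify ∘ u t) k' ≠ 0 →
      κ ^ 2 * (n : ℝ) ^ 2 ≤ freqNormSq k' := by
    filter_upwards [hclass] with t ht k' hk'
    have hmem : (∃ z : Fin 3 → ℤ, k' = ℓ + (n : ℤ) • z) ∨ (∃ z : Fin 3 → ℤ, k' = -ℓ + (n : ℤ) • z) := by
      by_contra hcon
      rw [not_or] at hcon
      exact hk' (ht k' hcon.1 hcon.2)
    exact freqNormSq_ge_of_classPair hκ.le hfar hmem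
  have hlow := ae_gap_lower_bound_frame hu hlo' hEae hQblock hcoer' (ρ := κ ^ 2 * (n : ℝ) ^ 2) (by positivity) hgap
  have hdec : ∀ t ∈ Icc 0 T, E t ≤ Real.exp (-(8 * Real.pi ^ 2 * ((1 / (n:ℝ) ^ 2) * (ν * (lo / Λ)) * c₀) * (κ ^ 2 * (n : ℝ) ^ 2) * t)) * E 0 :=
    fun t ht => energy_le_exp_of_gap hAC hEd hlow ht
  filter_upwards [hEae, ae_restrict_mem measurableSet_Ioo] with t hEt htI
  rw [← hEt]
  have h1 := hdec t ⟨htI.1.le, htI.2.le⟩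
  rw [hE0] at h1
  have e : 8 * Real.pi ^ 2 * ((1 / (n:ℝ) ^ 2) * (ν * (lo / Λ)) * c₀) * (κ ^ 2 * (n : ℝ) ^ 2) * t =
      2 * (4 * Real.pi ^ 2 * lo * c₀ * κ ^ 2 / Λ) * ν * t := by
    field_simp
    ring
  rw [e, ← one_mul (Real.exp _)] at h1
  exact h1

end Summit.AnomalousDissipation.AnomalousDissipation.Theorems.SolenoidalFractalHomogenisation.LagrangianStep.CellChain

end
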